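import Literature.Geometry.Symplectic.TubeTaylorRemainder
import Literature.Geometry.Symplectic.PfaffianEstimates
import Literature.Analysis.Calculus.AxisPoincareHomotopySmooth
import HarnessLib

/-!
# The primitive `η = K(ω_A − ω)` of the gluing along an even zero circle

Topic `Geometry/Symplectic`; namespace `Literature.Geometry.Symplectic`.  Theorems only; no named
fact, no `sorry`.  Model-level step of the gluing `ω' = ω + d(ρ · K(ω_A − ω))` (Perutz 2006,
proof of Lemma 3.1, steps 2–3, with the Moser flow replaced by a cut-off): for a `C^∞`, closed,
`2π`-periodic `Λ²`-valued `G` on the model tube `hondaTube r` vanishing on the axis, and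
`0 < r₂ < r`, we construct a GLOBAL `C^∞`, `2π`-periodic `1`-form `η` with

* `dη = ω_A − G` on `hondaTube r₂` (relative Poincaré lemma along the axis,
  `extDeriv_axisPrimitive_of_closed_of_apply_base`, applied to a cut-off extension of `ω_A − G`),
* `‖η(q)‖ ≤ C |x|²` and `‖ω_A(q) − G(q)‖ ≤ C₁ |x|` on `|x| ≤ r₂`

(`exists_gluingPrimitive`).  Here `ω_A = hondaFormCLM` is Honda's model and `|x|` the distance to
the axis.

## References

* T. Perutz, *Zero-sets of near-symplectic forms*, J. Symplectic Geom. 4 (2006), §3, proof of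
  Lemma 3.1. [Perutz2006]
* R. Bott, L. Tu, *Differential Forms in Algebraic Topology* (1982), I §4, §6. [BottTu1982]
-/

noncomputable section

open scoped Manifold ContDiff Topology Real
open Set Function Filter Metric Real Literature.Analysis.Calculus Literature.Geometry.Kaehler

namespace Literature.Geometry.Symplectic

/-! ### The axis projection and the tube -/

/-- The axis projection `P q = q₀ e₀` as a continuous linear map (existence with its formula).
[folklore] -/
theorem exists_axisProjCLM :
    ∃ P : EuclideanSpace ℝ (Fin 4) →L[ℝ] EuclideanSpace ℝ (Fin 4),
      ∀ q, P q = hondaAxisPoint (q 0) :=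
  ⟨(EuclideanSpace.proj (0 : Fin 4)).smulRight (EuclideanSpace.single (0 : Fin 4) (1 : ℝ)),
    fun _ ↦ rfl⟩

/-- Membership in the tube through the distance to the axis. [folklore] -/
theorem mem_hondaTube_iff_norm {r : ℝ} {q : EuclideanSpace ℝ (Fin 4)} :
    q ∈ hondaTube r ↔ ‖q - hondaAxisPoint (q 0)‖ < |r| := by
  rw [mem_hondaTube, ← norm_sub_hondaAxisPoint_sq, ← sq_abs r, sq_lt_sq, abs_norm, abs_abs]

/-- Membership in a tube of positive radius. [folklore] -/
theorem mem_hondaTube_iff_norm_lt {r : ℝ} (hr : 0 < r) {q : EuclideanSpace ℝ (Fin 4)} :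
    q ∈ hondaTube r ↔ ‖q - hondaAxisPoint (q 0)‖ < r := by
  rw [mem_hondaTube_iff_norm, abs_of_pos hr]

/-- The model tube is convex. [folklore] -/
theorem convex_hondaTube (r : ℝ) : Convex ℝ (hondaTube r) := by
  obtain ⟨L, hL⟩ := exists_normalProjCLM
  have h : hondaTube r = (L : EuclideanSpace ℝ (Fin 4) →ₗ[ℝ] EuclideanSpace ℝ (Fin 4)) ⁻¹'
      ball 0 |r| := by
    ext q
    rw [mem_hondaTube_iff_norm, mem_preimage, mem_ball_zero_iff, ContinuousLinearMap.coe_coe, hL]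
  rw [h]
  exact (convex_ball _ _).linear_preimage _

/-- Points of the segment from the axis foot: `h_t(q) = q₀e₀ + t (q − q₀e₀)` has axis coordinate
`q₀` and normal part `t (q − q₀ e₀)`. [folklore] -/
theorem conePt_axis_sub (q : EuclideanSpace ℝ (Fin 4)) (t : ℝ) :
    conePt (hondaAxisPoint (q 0)) q t - hondaAxisPoint ((conePt (hondaAxisPoint (q 0)) q t) 0) =
      t • (q - hondaAxisPoint (q 0)) := by
  have h0 : (conePt (hondaAxisPoint (q 0)) q t) 0 = q 0 := by
    simp [conePt, hondaAxisPoint]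
  rw [h0, conePt, add_sub_cancel_left]

/-- On the segment from the axis foot the distance to the axis is `t |x|`. [folklore] -/
theorem norm_conePt_axis_sub (q : EuclideanSpace ℝ (Fin 4)) {t : ℝ} (ht : 0 ≤ t) :
    ‖conePt (hondaAxisPoint (q 0)) q t -
        hondaAxisPoint ((conePt (hondaAxisPoint (q 0)) q t) 0)‖ =
      t * ‖q - hondaAxisPoint (q 0)‖ := by
  rw [conePt_axis_sub, norm_smul, Real.norm_of_nonneg ht]

/-! ### Honda's model as a function -/

/-- `ω_A` vanishes on the axis. [folklore] -/
theorem hondaFormCLM_hondaAxisPoint (θ : ℝ) : hondaFormCLM (hondaAxisPoint θ) = 0 := by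
  rw [hondaFormCLM_eq_betaForm]
  have : normalPart (hondaAxisPoint θ) = 0 := by
    funext k; simp [normalPart_apply, hondaAxisPoint_apply_succ]
  rw [this, Matrix.mulVec_zero, betaForm_zero]

/-- `ω_A` is invariant under axis translations. [folklore] -/
theorem hondaFormCLM_add_smul_single (q : EuclideanSpace ℝ (Fin 4)) (c : ℝ) :
    hondaFormCLM (q + c • EuclideanSpace.single (0 : Fin 4) (1 : ℝ)) = hondaFormCLM q := by
  rw [map_add, map_smul]
  have : hondaFormCLM (EuclideanSpace.single (0 : Fin 4) (1 : ℝ)) = 0 := by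
    have h := hondaFormCLM_hondaAxisPoint 1
    simpa [hondaAxisPoint] using h
  rw [this, smul_zero, add_zero]

/-- `ω_A` is closed, as an identity for Mathlib's `extDeriv` of the function `q ↦ ω_A(q)`.
[cite: Perutz2006, §2 eq. (2)] -/
theorem extDeriv_hondaFormCLM (q : EuclideanSpace ℝ (Fin 4)) :
    extDeriv (fun y ↦ hondaFormCLM y) q = 0 := by
  rw [extDeriv]
  have hf : fderiv ℝ (fun y ↦ hondaFormCLM y) q = hondaFormCLM := hondaFormCLM.fderiv
  rw [hf, alternatizeUncurryFin_hondaFormCLM]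

/-! ### The primitive -/

set_option maxHeartbeats 800000 in
/-- **The gluing primitive.**  For `G` `C^∞`, closed and `2π`-periodic on `hondaTube r`,
vanishing on the axis, and `0 < r₂ < r`: a global `C^∞`, `2π`-periodic `1`-form `η` with
`dη = ω_A − G` on `hondaTube r₂`, `‖η(q)‖ ≤ C |x|²` and `‖ω_A(q) − G(q)‖ ≤ C₁ |x|` for
`|x| ≤ r₂`. [cite: Perutz2006, §3 (proof of Lemma 3.1, steps 2–3)] -/
theorem exists_gluingPrimitive
    {G : EuclideanSpace ℝ (Fin 4) → (EuclideanSpace ℝ (Fin 4)) [⋀^Fin 2]→L[ℝ] ℝ} {r r₂ : ℝ}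
    (hr₂ : 0 < r₂) (hr₂r : r₂ < r) (hGs : ContDiffOn ℝ ∞ G (hondaTube r))
    (hGper : ∀ q, G (q + (2 * π) • EuclideanSpace.single (0 : Fin 4) (1 : ℝ)) = G q)
    (hGcl : ∀ q ∈ hondaTube r, extDeriv G q = 0) (hG0 : ∀ θ, G (hondaAxisPoint θ) = 0) :
    ∃ (η : EuclideanSpace ℝ (Fin 4) → (EuclideanSpace ℝ (Fin 4)) [⋀^Fin 1]→L[ℝ] ℝ) (C C₁ : ℝ),
      ContDiff ℝ ∞ η ∧
      (∀ q, η (q + (2 * π) • EuclideanSpace.single (0 : Fin 4) (1 : ℝ)) = η q) ∧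
      (∀ q ∈ hondaTube r₂, extDeriv η q = hondaFormCLM q - G q) ∧
      0 ≤ C ∧ 0 ≤ C₁ ∧
      (∀ q, ‖q - hondaAxisPoint (q 0)‖ ≤ r₂ →
        ‖η q‖ ≤ C * ‖q - hondaAxisPoint (q 0)‖ ^ 2) ∧
      (∀ q, ‖q - hondaAxisPoint (q 0)‖ ≤ r₂ →
        ‖hondaFormCLM q - G q‖ ≤ C₁ * ‖q - hondaAxisPoint (q 0)‖) := by
  have hr : 0 < r := hr₂.trans hr₂r
  have hopen := isOpen_hondaTube r
  -- the difference `τ = ω_A − G` on the tube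
  set τf : EuclideanSpace ℝ (Fin 4) → (EuclideanSpace ℝ (Fin 4)) [⋀^Fin 2]→L[ℝ] ℝ :=
    fun q ↦ hondaFormCLM q - G q with hτf
  have hΘs : ContDiff ℝ ∞ fun q : EuclideanSpace ℝ (Fin 4) ↦ hondaFormCLM q := hondaFormCLM.contDiff
  have hτfs : ContDiffOn ℝ ∞ τf (hondaTube r) := hΘs.contDiffOn.sub hGs
  have hτfper : ∀ q, τf (q + (2 * π) • EuclideanSpace.single (0 : Fin 4) (1 : ℝ)) = τf q :=
    fun q ↦ by simp only [hτf, hondaFormCLM_add_smul_single, hGper]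
  have hτf0 : ∀ θ, τf (hondaAxisPoint θ) = 0 := fun θ ↦ by
    simp only [hτf, hondaFormCLM_hondaAxisPoint, hG0, sub_zero]
  have hτfcl : ∀ q ∈ hondaTube r, extDeriv τf q = 0 := by
    intro q hq
    have hGd : DifferentiableAt ℝ G q := (hGs.contDiffAt (hopen.mem_nhds hq)).differentiableAt
      (by simp)
    have hsub : fderiv ℝ τf q = fderiv ℝ (fun y ↦ hondaFormCLM y) q - fderiv ℝ G q :=
      fderiv_fun_sub (hΘs.contDiffAt.differentiableAt (by simp)) hGd
    have h1 := extDeriv_hondaFormCLM q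
    have h2 := hGcl q hq
    rw [extDeriv] at h1 h2 ⊢
    rw [hsub, ← ContinuousAlternatingMap.alternatizeUncurryFinCLM_apply, map_sub,
      ContinuousAlternatingMap.alternatizeUncurryFinCLM_apply,
      ContinuousAlternatingMap.alternatizeUncurryFinCLM_apply, h1, h2, sub_zero]
  -- first-order size of `τ` on the slab `|x| ≤ r₂`
  obtain ⟨C₁, C₂, hC₁, -, hτfb⟩ := exists_axis_taylor_bounds (V := (EuclideanSpace ℝ (Fin 4))
    [⋀^Fin 2]→L[ℝ] ℝ) (hτfs.of_le (by norm_cast)) hτfper hτf0 hr₂ hr₂r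
  -- a cut-off extension of `τ` to all of `ℝ⁴`
  set r₃ : ℝ := (r₂ + r) / 2 with hr₃
  have hr₂₃ : r₂ < r₃ := by rw [hr₃]; linarith
  have hr₃r : r₃ < r := by rw [hr₃]; linarith
  obtain ⟨ψ, hψs, hψ1, hψ0, hψper⟩ := exists_tubeCutoff hr₂ hr₂₃
  set τ : EuclideanSpace ℝ (Fin 4) → (EuclideanSpace ℝ (Fin 4)) [⋀^Fin 2]→L[ℝ] ℝ :=
    fun q ↦ ψ q • τf q with hτ
  have hdist : Continuous fun q : EuclideanSpace ℝ (Fin 4) ↦ ‖q - hondaAxisPoint (q 0)‖ := by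
    obtain ⟨L, hL⟩ := exists_normalProjCLM
    have : (fun q : EuclideanSpace ℝ (Fin 4) ↦ ‖q - hondaAxisPoint (q 0)‖) = fun q ↦ ‖L q‖ :=
      funext fun q ↦ by rw [hL]
    rw [this]; exact continuous_norm.comp L.continuous
  have hτs : ContDiff ℝ ∞ τ := by
    refine contDiff_iff_contDiffAt.2 fun q ↦ ?_
    by_cases hq : ‖q - hondaAxisPoint (q 0)‖ < r
    · have hqT : q ∈ hondaTube r := (mem_hondaTube_iff_norm_lt hr).2 hq
      exact hψs.contDiffAt.smul (hτfs.contDiffAt (hopen.mem_nhds hqT))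
    · -- near `q`, `|x| > r₃` and `τ = 0`
      have hq' : r₃ < ‖q - hondaAxisPoint (q 0)‖ := lt_of_lt_of_le hr₃r (not_lt.1 hq)
      have hev : τ =ᶠ[𝓝 q] fun _ ↦ 0 := by
        filter_upwards [(isOpen_lt continuous_const hdist).mem_nhds hq'] with q' hq'
        simp only [hτ, hψ0 q' hq'.le, zero_smul]
      exact (contDiffAt_const (c := (0 : (EuclideanSpace ℝ (Fin 4)) [⋀^Fin 2]→L[ℝ] ℝ))).congr_of_eventuallyEq
        hev
  have hτeq : ∀ q, ‖q - hondaAxisPoint (q 0)‖ ≤ r₂ → τ q = τf q := fun q hq ↦ by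
    simp only [hτ, hψ1 q hq, one_smul]
  have hτper : ∀ q, τ (q + (2 * π) • EuclideanSpace.single (0 : Fin 4) (1 : ℝ)) = τ q :=
    fun q ↦ by simp only [hτ, hψper, hτfper]
  -- `τ` is closed on `hondaTube r₂` (there `τ = τf` locally)
  have hτcl : ∀ q ∈ hondaTube r₂, extDeriv τ q = 0 := by
    intro q hq
    have hev : τ =ᶠ[𝓝 q] τf := by
      filter_upwards [(isOpen_hondaTube r₂).mem_nhds hq] with q' hq'
      exact hτeq q' ((mem_hondaTube_iff_norm_lt hr₂).1 hq').le
    rw [hev.extDeriv_eq]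
    exact hτfcl q (hondaTube_mono hr₂.le hr₂r.le hq)
  -- the axis projection and the primitive
  obtain ⟨P, hP⟩ := exists_axisProjCLM
  have hPtube : ∀ y ∈ hondaTube r₂, P y ∈ hondaTube r₂ := fun y _ ↦ by
    rw [hP]; exact hondaAxis_subset_hondaTube hr₂ (hondaAxisPoint_mem_hondaAxis _)
  have hPrank : ∀ v : EuclideanSpace ℝ (Fin 4), ∃ c : ℝ,
      P v = c • EuclideanSpace.single (0 : Fin 4) (1 : ℝ) := fun v ↦ ⟨v 0, by rw [hP]; rfl⟩
  have hPp : P ((2 * π) • EuclideanSpace.single (0 : Fin 4) (1 : ℝ)) =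
      (2 * π) • EuclideanSpace.single (0 : Fin 4) (1 : ℝ) := by
    rw [hP]; simp [hondaAxisPoint]
  set η := axisPrimitive P τ with hη
  have hηs : ContDiff ℝ ∞ η := contDiff_axisPrimitive P hτs
  have hηper : ∀ q, η (q + (2 * π) • EuclideanSpace.single (0 : Fin 4) (1 : ℝ)) = η q :=
    fun q ↦ axisPrimitive_add_of_forall hPp hτper q
  -- `dη = τ` on `hondaTube r₂`
  have hdη : ∀ q ∈ hondaTube r₂, extDeriv η q = hondaFormCLM q - G q := by
    intro q hq
    have h1 : (∞ : WithTop ℕ∞) ≠ 0 := by simp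
    obtain ⟨C, hC⟩ := exists_bound_segments P hτs.continuous (hτs.continuous_fderiv h1) q
    obtain ⟨δ, hδ, hball⟩ := Metric.isOpen_iff.1 (isOpen_hondaTube r₂) q hq
    have hball' : ball q (min δ 1) ⊆ hondaTube r₂ :=
      (ball_subset_ball (min_le_left _ _)).trans hball
    have hC' : ∀ y' ∈ ball q (min δ 1), ∀ t ∈ Icc (0 : ℝ) 1,
        ‖τ (conePt (P y') y' t)‖ ≤ C ∧ ‖fderiv ℝ τ (conePt (P y') y' t)‖ ≤ C :=
      fun y' hy' t ht ↦ hC y' (ball_subset_ball (min_le_right _ _) hy') t ht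
    have h0 : ∀ v w : EuclideanSpace ℝ (Fin 4), τ (P q) ![P v, P w] = 0 := fun v w ↦
      apply_pair_eq_zero_of_range_subset_span P hPrank (τ (P q)) v w
    rw [hη, extDeriv_axisPrimitive_of_closed_of_apply_base (convex_hondaTube r₂) hPtube
      (fun x _ ↦ ((hτs.differentiable h1) x).hasFDerivAt) hτs.continuous.continuousOn
      (hτs.continuous_fderiv h1).continuousOn hτcl (lt_min hδ one_pos) hball' hC' h0]
    exact hτeq q ((mem_hondaTube_iff_norm_lt hr₂).1 hq).le
  -- the quadratic bound for `η`
  set CP : ℝ := ‖P‖ + ‖ContinuousLinearMap.id ℝ (EuclideanSpace ℝ (Fin 4)) - P‖ with hCP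
  have hCP0 : 0 ≤ CP := by positivity
  have hηb : ∀ q, ‖q - hondaAxisPoint (q 0)‖ ≤ r₂ →
      ‖η q‖ ≤ CP * C₁ * ‖q - hondaAxisPoint (q 0)‖ ^ 2 := by
    intro q hq
    have hseg : ∀ t ∈ Icc (0 : ℝ) 1,
        ‖τ (conePt (P q) q t)‖ ≤ C₁ * ‖q - hondaAxisPoint (q 0)‖ := by
      intro t ht
      rw [hP]
      have hnorm := norm_conePt_axis_sub q ht.1
      have hle : ‖conePt (hondaAxisPoint (q 0)) q t -
          hondaAxisPoint ((conePt (hondaAxisPoint (q 0)) q t) 0)‖ ≤ r₂ := by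
        rw [hnorm]
        calc t * ‖q - hondaAxisPoint (q 0)‖ ≤ 1 * ‖q - hondaAxisPoint (q 0)‖ :=
              mul_le_mul_of_nonneg_right ht.2 (norm_nonneg _)
          _ ≤ r₂ := by rw [one_mul]; exact hq
      rw [hτeq _ hle]
      calc ‖τf (conePt (hondaAxisPoint (q 0)) q t)‖
          ≤ C₁ * ‖conePt (hondaAxisPoint (q 0)) q t -
              hondaAxisPoint ((conePt (hondaAxisPoint (q 0)) q t) 0)‖ := (hτfb _ hle).1
        _ = C₁ * (t * ‖q - hondaAxisPoint (q 0)‖) := by rw [hnorm]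
        _ ≤ C₁ * (1 * ‖q - hondaAxisPoint (q 0)‖) :=
            mul_le_mul_of_nonneg_left (mul_le_mul_of_nonneg_right ht.2 (norm_nonneg _)) hC₁
        _ = C₁ * ‖q - hondaAxisPoint (q 0)‖ := by rw [one_mul]
    have h := norm_axisPrimitive_le (P := P) (y := q) hseg
    have hyP : ‖q - P q‖ = ‖q - hondaAxisPoint (q 0)‖ := by rw [hP]
    rw [hyP] at h
    calc ‖η q‖ ≤ CP * (C₁ * ‖q - hondaAxisPoint (q 0)‖ * ‖q - hondaAxisPoint (q 0)‖) := h
      _ = CP * C₁ * ‖q - hondaAxisPoint (q 0)‖ ^ 2 := by ring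
  refine ⟨η, CP * C₁, C₁, hηs, hηper, hdη, mul_nonneg hCP0 hC₁, hC₁, hηb, fun q hq ↦ ?_⟩
  exact (hτfb q hq).1

end Literature.Geometry.Symplectic

end
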